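import Summits.CriticalPhenomena.PercolationContinuityZ3.Theorems.Transplant.PlanarSkeletonFrmFromDefs
import Summits.CriticalPhenomena.PercolationContinuityZ3.Theorems.Transplant.SkelFrmFromBChoiceDefsV
import Summits.CriticalPhenomena.PercolationContinuityZ3.Theorems.Transplant.SkelFrmBChoiceDefsV
import Summits.CriticalPhenomena.PercolationContinuityZ3.Theorems.Transplant.SkelNeg1ChoiceAll
import HarnessLib
import Summits.CriticalPhenomena.PercolationContinuityZ3.Theorems.Transplant.SkelFrmBChoiceGeomV
/-!
# U-WAVE PORT (RULING D-U, lead g21 2026-08-26; WAVE-U-MANIFEST v3.0 row «SkelFrmBChoiceGeomV» ↦ «SkelFrmFromBChoiceGeomV») of the tree module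
# `Transplant/SkelFrmBChoiceGeomV` onto the carrier `PlanarSkeletonFrmFrom` (frames only, cylinders connected from width `ℓ₀` on)

ORIGINAL TITLE: N2 (frames-only node `SamePDropOfSkeletonFrm₁`, OPEN), WAVE 1 under (R-44)/(R-45): THE GEOMETRIC OBLIGATION OF THE CHOICE FUNCTION OF RECORD, SECOND CELL PORT —

builds on p205010 (kernel theorem, internal audit signed; external expert review pending) — nothing in this file uses p205010; NOTHING is claimed about the
OPEN node U `SamePDropOfSkeletonFrmFrom₁` (nor U_s / the end state).  Lane `prim-bschramm`, seat `prim-bschramm-p3` gen 26; helper file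
(`--supports stmt-CriticalPhenomena-4575 --as helper`).  PORT RULES r1–r4 of RULING D-U: declaration order and proof texts are those of the original,
byte-identical except (i) the carrier token `PlanarSkeletonFrm ↦ PlanarSkeletonFrmFrom` (binders, `namespace`/`end` lines, qualified names of twinned
declarations), (ii) carrier-FREE declarations of the original (φ-level `Skelφ…` blocks and namespace-only arithmetic residents) are NOT re-declared —
this file imports the original and `export`s the twin-free residents (POLICY T / treatment (m1)); residents whose statement mentions a twinned
constant are copied, (iii) every carrier-binding declaration keeps its explicit binder `(Φ : PlanarSkeletonFrmFrom G)` in its own signature (r2).  Docstrings and citations are the original's.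
-/

noncomputable section

open scoped Classical

namespace Summit.CriticalPhenomena.PercolationContinuityZ3.Theorems.Transplant

open MeasureTheory Literature.Probability.Percolation Literature.Probability.LatticeModels SimpleGraph KNCells
open Literature.Barriers.CriticalPhenomena (HasExponentialGrowth graphBall)

namespace PlanarSkeletonFrmFrom

open SkelConc (Consts)
open BoxProdZ2 (ConcRadiiG)
open Skelφ (oriφ trφ)
open Skelφ.StepI (DataN DataNS OutNS)

namespace NegB

open Neg

section Geom

variable (κ : Consts) {V : Type} [DecidableEq V] [Countable V] {G : SimpleGraph V} [G.LocallyFinite] (Φ : PlanarSkeletonFrmFrom G) (t : V)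
  (p : unitInterval) (D : DataNS V) (g f : ℕ) (c hf : Fin 2 → ℕ)

/-! ## §1 The column point over the staggered centre (V cells) -/

/-- **THE COLUMN POINT over the STAGGERED centre (V cells)** for the fine map of the (ζ′) chain: for every cube `Q x` of the V cells `fcellsV … c hf` and every radius
`R ≥ NrepA (cenS x) + 1`, a vertex of fine position exactly `cenS x` inside the window span `VWin (Q x) R`. [cite: KozmaNitzan2024, §4 p. 26 ((29): columns)] -/
theorem hcol_fineA_atV (κ : Consts) {V : Type} [DecidableEq V] [Countable V] {G : SimpleGraph V} [G.LocallyFinite] (Φ : PlanarSkeletonFrmFrom G) (t : V) (p : unitInterval) (D : DataNS V) (g : ℕ) (f : ℕ) (c : Fin 2 → ℕ) (hf : Fin 2 → ℕ) {φ' : V → Site 2} (hlip : Skelφ.Lip G φ') (hstep : Skelφ.Steps G φ') (hN : EqNumL κ Φ t p D g f) (x : Site 2) {R : ℕ}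
    (hR : NrepA κ Φ t p D g f ((fcellsV κ Φ t p D g f c hf).cenS x) + 1 ≤ R) :
    ∃ y ∈ Skelφ.VWin G (fineA κ Φ t p D g f φ') t ((fcellsV κ Φ t p D g f c hf).Q x) R, fineA κ Φ t p D g f φ' y = (fcellsV κ Φ t p D g f c hf).cenS x := by
  obtain ⟨hn1, hℓ1⟩ := one_le_of_eqNumL κ Φ t p D g f hN
  obtain ⟨r0, r1⟩ := room_fcellsA_at κ Φ t p D g f hN
  have hD := Skelφ.NegPrm.DofA_pos (Aof_pos κ).2 hn1 hℓ1 (hL κ Φ t p D g f) (vL κ Φ t p D g f)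
  exact Skelφ.hcol_fineSkelV (A := Aof κ) (n := (nL κ Φ t p D g f : ℤ)) (h := hL κ Φ t p D g f) (vα := vL κ Φ t p D g f) (vβ := vβL κ Φ t p D g f) hlip hstep t
    (cA_pos κ Φ t p D g f 0) (cA_pos κ Φ t p D g f 1) hD r0 r1 (fcellsV κ Φ t p D g f c hf) x hR

/-- **`hcol` in the shape `sepGeomSG₂bV` consumes**, from a schedule whose cube radii dominate the column radius at the staggered centres of the V cells. [folklore] -/
theorem hcol_fineA_of_schedV (κ : Consts) {V : Type} [DecidableEq V] [Countable V] {G : SimpleGraph V} [G.LocallyFinite] (Φ : PlanarSkeletonFrmFrom G) (t : V) (p : unitInterval) (D : DataNS V) (g : ℕ) (f : ℕ) (c : Fin 2 → ℕ) (hf : Fin 2 → ℕ) {φ' : V → Site 2} (hlip : Skelφ.Lip G φ') (hstep : Skelφ.Steps G φ') (hN : EqNumL κ Φ t p D g f) {Λ : ConcRadiiG}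
    (hcolQ : ∀ a x, NrepA κ Φ t p D g f ((fcellsV κ Φ t p D g f c hf).cenS x) + 1 ≤ Λ.rQ a x) :
    ∀ a x, ∃ y ∈ Skelφ.VWin G (fineA κ Φ t p D g f φ') t ((fcellsV κ Φ t p D g f c hf).Q x) (Λ.rQ a x),
      fineA κ Φ t p D g f φ' y = (fcellsV κ Φ t p D g f c hf).cenS x :=
  fun a x => hcol_fineA_atV κ Φ t p D g f c hf hlip hstep hN x (hcolQ a x)

/-! ## §2 The nine conjuncts for the V cells with small boxes -/

/-- **THE NINE `GeomHoldsN` CONJUNCTS FOR THE V CELLS OF RECORD WITH SMALL BOXES, map slot `φ′`** (`cellGeomSG₂bV … b₀` for any `b₀ ≤ 3r`, any creep / forward-room values `c hf`).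
[cite: KozmaNitzan2024, §4 pp. 25–29] -/
theorem geom_fineA_at_bV (κ : Consts) {V : Type} [DecidableEq V] [Countable V] {G : SimpleGraph V} [G.LocallyFinite] (Φ : PlanarSkeletonFrmFrom G) (t : V) (p : unitInterval) (D : DataNS V) (g : ℕ) (f : ℕ) (c : Fin 2 → ℕ) (hf : Fin 2 → ℕ) {φ' : V → Site 2} (hlip : Skelφ.Lip G φ') (hstep : Skelφ.Steps G φ') (hN : EqNumL κ Φ t p D g f) {Λ : ConcRadiiG}
    (hΛ : Skelφ.WFS2 (fcellsV κ Φ t p D g f c hf).toPCells2 Λ) (hcolQ : ∀ a x, NrepA κ Φ t p D g f ((fcellsV κ Φ t p D g f c hf).cenS x) + 1 ≤ Λ.rQ a x)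
    {b₀ : Fin 2 → ℕ} (hb : ∀ i, b₀ i ≤ 3 * (fcellsV κ Φ t p D g f c hf).r i) :
    (Skelφ.cellGeomSG₂bV G (fineA κ Φ t p D g f φ') (fcellsV κ Φ t p D g f c hf) t Λ b₀).root = t ∧
      κ.K₀ ≤ (Skelφ.cellGeomSG₂bV G (fineA κ Φ t p D g f φ') (fcellsV κ Φ t p D g f c hf) t Λ b₀).K ∧
      Skelφ.Lip G (fineA κ Φ t p D g f φ') ∧
      RunGeom G (Skelφ.cellGeomSG₂bV G (fineA κ Φ t p D g f φ') (fcellsV κ Φ t p D g f c hf) t Λ b₀) ∧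
      AnchGeom (Skelφ.cellGeomSG₂bV G (fineA κ Φ t p D g f φ') (fcellsV κ Φ t p D g f c hf) t Λ b₀) ∧
      SepGeom₂ G (Skelφ.cellGeomSG₂bV G (fineA κ Φ t p D g f φ') (fcellsV κ Φ t p D g f c hf) t Λ b₀) ∧
      ExitGeom G (Skelφ.cellGeomSG₂bV G (fineA κ Φ t p D g f φ') (fcellsV κ Φ t p D g f c hf) t Λ b₀) ∧
      StepsGeom (Skelφ.cellGeomSG₂bV G (fineA κ Φ t p D g f φ') (fcellsV κ Φ t p D g f c hf) t Λ b₀)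
        (Skelφ.faceDataSGV G (fineA κ Φ t p D g f φ') (fcellsV κ Φ t p D g f c hf) t Λ) ∧
      LevelGeom G (Skelφ.cellGeomSG₂bV G (fineA κ Φ t p D g f φ') (fcellsV κ Φ t p D g f c hf) t Λ b₀)
        (Skelφ.faceDataSGV G (fineA κ Φ t p D g f φ') (fcellsV κ Φ t p D g f c hf) t Λ)
        (Skelφ.levelDataSV (fineA κ Φ t p D g f φ') (fcellsV κ Φ t p D g f c hf)) := by
  have hψ0 := fineA_base_at κ Φ t p D g f φ' hN
  have hlipψ := lip_fineA_at κ Φ t p D g f hlip hN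
  have hws := weakSteps_fineA_at κ Φ t p D g f hstep hN
  have hcol := hcol_fineA_of_schedV κ Φ t p D g f c hf hlip hstep hN hcolQ
  refine ⟨rfl, (fcellsA_K κ Φ t p D g f).2.1, hlipψ, Skelφ.runGeomSG₂bV _ _ _, Skelφ.anchGeomSG₂bV _ _ _,
    Skelφ.sepGeom₂SG₂bV _ _ _ hΛ hψ0 hlipψ hws hcol, Skelφ.exitGeomSG₂bV _ _ _ hΛ hlipψ hb, Skelφ.stepsGeomSG₂bV _ _ _ hΛ hlipψ hws hb,
    Skelφ.levelGeomSG₂bV _ _ _ hΛ hlipψ hb⟩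

end Geom

end NegB

/-! ## §3 The geometric obligation of the choice function of record under (R-44)/(R-45) -/

/-- **`GeomHoldsNQFn (frmChoiceAllQ3V gv fv Pv Sv cv hv bv)` FOR EVERY SLOT VALUE** — the Geom column obligation of the node theorem at THE CHOICE FUNCTION OF RECORD
(the V scheme over the V cells of record; `bOf ≤ 3r` by `bOf_leV`, the column floor at the staggered centre by `colQ_schedOfT`, the long clause from `FactsNS`). [cite: KozmaNitzan2024, §4 pp. 25–29] -/
theorem geomHoldsNQFn_frmChoiceAllQ3V (gv fv : PlanarSkeletonFrmFrom.Neg.FSlot) (Pv : NegB.PSlot) (Sv : NegB.SSlot) (cv hv : NegB.CSlot) (bv : NegB.BSlot) :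
    GeomHoldsNQFn (frmChoiceAllQ3V gv fv Pv Sv cv hv bv) := by
  intro κ V _ _ G _ Φ hg t ht h1 p hp0 hp1 hC O q hAt
  obtain ⟨-, -, hR, -, -⟩ := Skelφ.StepI.OutO.FactsO.shared hAt.1.factsO
  obtain ⟨h1', h2, -, h4, h5, h6, h7, h8, h9⟩ := NegB.geom_fineA_at_bV κ Φ t p O.merged (NegB.gOf κ Φ t p O gv) (NegB.fOf κ Φ t p O fv)
    (NegB.cOf κ Φ t p O gv fv cv) (NegB.hOf κ Φ t p O gv fv hv)
    (NegB.lip_φL κ Φ t p O.D O.DT.toDataN O.ori (NegB.gOf κ Φ t p O gv) (NegB.fOf κ Φ t p O fv))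
    (NegB.steps_φL κ Φ t p O.D O.DT.toDataN O.ori (NegB.gOf κ Φ t p O gv) (NegB.fOf κ Φ t p O fv))
    (NegB.eqNumL_of_factsO κ Φ t p O.D O.DT.toDataN O.ori _ _ hR (Skelφ.StepI.OutO.FactsO.clauses hAt.1.factsO))
    (NegB.schedOfT_WFS2 κ Φ t p O.merged (NegB.gOf κ Φ t p O gv) (NegB.fOf κ Φ t p O fv) (NegB.cOf κ Φ t p O gv fv cv)
      (Sv κ Φ t p O.merged (NegB.gOf κ Φ t p O gv) (NegB.fOf κ Φ t p O fv) q))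
    (NegB.colQ_schedOfT κ Φ t p O.merged (NegB.gOf κ Φ t p O gv) (NegB.fOf κ Φ t p O fv) (NegB.cOf κ Φ t p O gv fv cv)
      (Sv κ Φ t p O.merged (NegB.gOf κ Φ t p O gv) (NegB.fOf κ Φ t p O fv) q))
    (NegB.bOf_leV κ Φ t p O gv fv cv hv bv)
  exact ⟨h1', h2, h4, h5, h6, h7, h8, h9⟩

end PlanarSkeletonFrmFrom

end Summit.CriticalPhenomena.PercolationContinuityZ3.Theorems.Transplant

end
-- build-touch 2026-08-25T06:15:53Z T1-A (lead g18): re-land of p391452, declarations byte-identical
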